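import Literature.Barriers.CriticalPhenomena.AmenableInvariantPercolation

/-!
# Barrier audit gen-18 (2026-08-16): the FKG-LATTICE (monotonic) door — two exact anchors

Barrier catalogue `Literature/Barriers/CriticalPhenomena/` (D-0021); audit artifact of
`AmenableInvariantPercolationProofs.lean` / `AmenableInvariantPercolation.lean`. The one door left
OPEN by the audits of gens 1–17 of the entry `AmenableInvariantPercolation` is gen-16 (3): does the
FKG LATTICE CONDITION alone — `μ(ω ∨ ω') μ(ω ∧ ω') ≥ μ(ω) μ(ω')` on every finite window, for
strictly positive cylinder marginals equivalent to strong positive association and to monotonicity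
[cite: Grimmett2006, Thm. (2.24)] — restore a size-blind finite-cluster density threshold over
translation-invariant laws on `{0,1}^{ℤ^d}`? Every catalogued Thm. 8.37 witness violates it (hard
core, or crossing rigidity [cite: Grimmett2006, Example (2.26)]; module docstring gen-16 (1) of
`AmenableInvariantPercolation.lean`). Gen-18 does not settle the question; it records the exact
DOMINATION TEST inside the class, in print, and two finite anchors, proved here.

* IN PRINT. For a translation-invariant law `μ` on `{0,1}^{ℤ^d}` that is *downward FKG* — the
  conditional law given "all closed on `A`" is positively associated for every finite `A`
  [cite: LiggettSteif2006, Definition 1.1], which the lattice condition implies — `μ` dominates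
  Bernoulli(`ρ`) iff `μ(Λ_n entirely closed) ≤ (1-ρ)^{n^d}` for all (large) `n`, iff
  `μ(0 open | A closed, B open) ≥ ρ` for all finite disjoint `A`, `B` in the lexicographic past
  [cite: LiggettSteif2006, Theorem 4.1 (and Remark (1); Theorem 1.2 for d = 1)]. Hence a
  non-percolating law of the class has solid-cube rate `limsup_n μ(Λ_n closed)^{1/n^d} ≥
  1 - p_c^site(ℤ^d)`: SOLID closed cubes at a bounded exponential-in-volume cost — a size-blind,
  non-local criterion that excludes at once every hard-wall witness (grid, hard-core hyperplanes:
  `μ(Λ_2 closed) = 0`), and inside the class identifies the closed-contour functional of gen-8 with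
  the Bernoulli-domination functional of evasion (i).
* ANCHOR 1 (`latticeCondition_stack`, `latticeCondition_prod_le`): the criterion is nevertheless
  void against wall-carrying monotonic laws — under the lattice condition the atom probabilities
  `p(S) = P[closed set of the window = S]` satisfy `p(∅)^{k-1} p(R₁ ∪ ⋯ ∪ R_k) ≥ ∏ p(R_i)` for
  pairwise disjoint `R_i` (take `R_i` = the `m` unit layers of `Λ_m`): a solid closed cube is never
  dearer than an independent stack of the law's own bare walls, so the solid-cube rate of such a
  law is `1` as soon as bare wall atoms have probability `e^{-o(m^{d-1})}` (e.g. the `δ/√(2m)`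
  allowed by gen-16 (1)). [folklore]
* ANCHOR 2 (`tp2Kernel_two_inputs`): no DIRECTED (causal) construction can produce a monotonic
  caging law — a Markov kernel `{0,1}² → {0,1}` whose joint weight with its inputs is TP₂ in every
  pair of coordinates (so that composition [cite: KarlinRinott1980, (1.15)–(1.16)] keeps the
  space-time law MTP₂) ignores one of its inputs: with `a = k(00→1) ≤ u = k(10→1), v = k(01→1) ≤
  c = k(11→1)`, the two TP₂ conditions `uv ≤ ac` (output `1`) and `(1-u)(1-v) ≤ (1-a)(1-c)`
  (output `0`) force `{u, v} = {a, c}`. So space-time laws of attractive probabilistic cellular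
  automata with genuinely two-input rules (Toom, Stavskaya, noisy majority) are not monotonic, and
  "hidden-layer AND" designs fail for the same reason (integrating out a spin coupled
  ferromagnetically to `k` hidden spins reweights them by the log-supermodular `∏ cosh`). [folklore]

What remains (module docstring gen-18 of `AmenableInvariantPercolation.lean`): the MTP₂ sources —
attractive Markov fields (agreement percolation [cite: GeorgiiHaggstromMaes2001, Thm. 8.1 and Thm. 8.2]),
monotone site-wise images of Gaussian fields with M-matrix precision
[cite: KarlinRinott1980, Example 3.1 (Sarkar; Barlow–Proschan) and Prop. 3.2] (killed Green
kernels decay, and for regularly varying covariance the critical level is `≤ 0`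
[cite: MuirheadSevero2024, Proposition 1.9 and Remark 1.10]), unions of independent grains
(explaining away), causal kernels (Anchor 2) — all fail to cage at density `> 1/2` or are not
monotonic; an MTP₂ caging law of density `→ 1`, if it exists, is of a new kind. No lever for the
BLPS `ξ_ε` either way [cite: LyonsPeres2016, Thm. 8.21 (proof, p. 403)].

## References

* T. M. Liggett, J. E. Steif, *Stochastic domination: the contact process, Ising models and FKG
  measures*, Ann. Inst. H. Poincaré Probab. Statist. 42 (2006) 223–243 (arXiv:math/0504530):
  Def. 1.1, Thm. 1.2, Thm. 4.1 and Remark (1), Prop. 1.2. [LiggettSteif2006]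
* S. Karlin, Y. Rinott, *Classes of orderings of measures and related correlation inequalities.
  I. Multivariate totally positive distributions*, J. Multivariate Anal. 10 (1980) 467–498:
  (1.15)–(1.16), Example 3.1, Prop. 3.2, Prop. 3.7. [KarlinRinott1980]
* S. Muirhead, F. Severo, *Percolation of strongly correlated Gaussian fields I*, Probab. Math.
  Phys. 5 (2024) 357–412 (arXiv:2206.10723), Prop. 1.9, Remark 1.10. [MuirheadSevero2024]
* G. Grimmett, *The Random-Cluster Model*, Springer 2006, §2.2 ((2.15), Thm. (2.24),
  Example (2.26)). [Grimmett2006]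
-/

namespace Literature.Barriers.CriticalPhenomena

/-! ### Anchor 1: stacking under the FKG lattice condition -/

section Stack

variable {α : Type*} [DecidableEq α]

/-- A set disjoint from every member of a list is disjoint from the list's union. [folklore] -/
theorem disjoint_foldr_union (R : Finset α) :
    ∀ l : List (Finset α), (∀ T ∈ l, Disjoint R T) → Disjoint R (l.foldr (· ∪ ·) ∅)
  | [], _ => by simp
  | T :: l, h => by
      simp only [List.foldr_cons]
      exact Finset.disjoint_union_right.2
        ⟨h T (by simp), disjoint_foldr_union R l fun U hU => h U (by simp [hU])⟩

/-- **Stacking under the FKG lattice condition.** Let `p : Finset α → ℝ` be non-negative and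
log-supermodular, `p S · p T ≤ p (S ∪ T) · p (S ∩ T)` — e.g. the atom probabilities
`p S = P[the closed set of a finite window is exactly S]` of a law satisfying the FKG lattice
condition [cite: Grimmett2006, Thm. (2.24)] (the condition `μ(ω ∨ ω')μ(ω ∧ ω') ≥ μ(ω)μ(ω')`
read on complements). Then for pairwise disjoint `R₁, …, R_k`,
`p ∅ · ∏ p R_i ≤ (p ∅)^k · p (R₁ ∪ ⋯ ∪ R_k)`: with `R_i` the unit layers of a cube, a solid
closed cube is never dearer than an independent stack of bare closed walls, so the solid-cube
domination test of [cite: LiggettSteif2006, Theorem 4.1] is passed by every monotonic law whose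
bare wall atoms have probability `e^{-o(area)}` (audit gen-18). [folklore] -/
theorem latticeCondition_stack (p : Finset α → ℝ) (hp0 : ∀ S, 0 ≤ p S)
    (hp : ∀ S T, p S * p T ≤ p (S ∪ T) * p (S ∩ T)) :
    ∀ l : List (Finset α), l.Pairwise Disjoint →
      p ∅ * (l.map p).prod ≤ p ∅ ^ l.length * p (l.foldr (· ∪ ·) ∅)
  | [], _ => by simp
  | R :: l, h => by
      rw [List.pairwise_cons] at h
      obtain ⟨hR, hl⟩ := h
      have ih := latticeCondition_stack p hp0 hp l hl
      have hdisj : R ∩ l.foldr (· ∪ ·) ∅ = ∅ :=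
        Finset.disjoint_iff_inter_eq_empty.1 (disjoint_foldr_union R l hR)
      have h1 : p R * p (l.foldr (· ∪ ·) ∅) ≤ p (R ∪ l.foldr (· ∪ ·) ∅) * p ∅ := by
        simpa [hdisj] using hp R (l.foldr (· ∪ ·) ∅)
      simp only [List.map_cons, List.prod_cons, List.length_cons, List.foldr_cons, pow_succ]
      calc p ∅ * (p R * (l.map p).prod) = p R * (p ∅ * (l.map p).prod) := by ring
        _ ≤ p R * (p ∅ ^ l.length * p (l.foldr (· ∪ ·) ∅)) :=
          mul_le_mul_of_nonneg_left ih (hp0 R)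
        _ = p ∅ ^ l.length * (p R * p (l.foldr (· ∪ ·) ∅)) := by ring
        _ ≤ p ∅ ^ l.length * (p (R ∪ l.foldr (· ∪ ·) ∅) * p ∅) :=
          mul_le_mul_of_nonneg_left h1 (pow_nonneg (hp0 ∅) _)
        _ = p ∅ ^ l.length * p ∅ * p (R ∪ l.foldr (· ∪ ·) ∅) := by ring

/-- **Corollary (probabilities).** If moreover `0 < p ∅ ≤ 1` (a probability law giving positive
mass to the all-open window), then for a non-empty pairwise disjoint family the atom of the union
dominates the product of the atoms: `∏ p R_i ≤ p (R₁ ∪ ⋯ ∪ R_k)`. For the closed set of a window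
under a monotonic law [cite: Grimmett2006, Thm. (2.24)]: `P[Λ_m closed] ≥ ∏_{layers} P[closed
set = that layer]`, the stacking bound behind the gen-18 reading of
[cite: LiggettSteif2006, Theorem 4.1]. [folklore] -/
theorem latticeCondition_prod_le (p : Finset α → ℝ) (hp0 : ∀ S, 0 ≤ p S)
    (hp : ∀ S T, p S * p T ≤ p (S ∪ T) * p (S ∩ T)) (hpos : 0 < p ∅) (hle : p ∅ ≤ 1)
    {l : List (Finset α)} (hl : l.Pairwise Disjoint) (hne : l ≠ []) :
    (l.map p).prod ≤ p (l.foldr (· ∪ ·) ∅) := by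
  have hlen : 1 ≤ l.length := Nat.succ_le_of_lt (List.length_pos_of_ne_nil hne)
  have hstack := latticeCondition_stack p hp0 hp l hl
  have hpow : p ∅ ^ l.length ≤ p ∅ ^ 1 := pow_le_pow_of_le_one hpos.le hle hlen
  have h2 : p ∅ * (l.map p).prod ≤ p ∅ * p (l.foldr (· ∪ ·) ∅) :=
    hstack.trans (by
      simpa using mul_le_mul_of_nonneg_right hpow (hp0 (l.foldr (· ∪ ·) ∅)))
  exact le_of_mul_le_mul_left h2 hpos

end Stack

/-! ### Anchor 2: a jointly TP₂ binary kernel with two inputs ignores one of them -/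

/-- **TP₂ kernels `{0,1}² → {0,1}` depend on one input only.** Let `a ≤ u, v ≤ c` lie in
`(0, 1)` — the probabilities of output `1` of a monotone kernel at inputs `00`, `10`, `01`, `11`.
If the joint weight is TP₂ in the two inputs for output `1` (`u v ≤ a c`) and for output `0`
(`(1-u)(1-v) ≤ (1-a)(1-c)`) — the two conditions that composition with an MTP₂ input law
[cite: KarlinRinott1980, (1.15)–(1.16)] requires beyond monotonicity — then `{u, v} = {a, c}`:
the kernel ignores one input. Consequence (audit gen-18): space-time laws of attractive
probabilistic cellular automata with genuinely two-input local rules are not monotonic in the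
sense of [cite: Grimmett2006, Thm. (2.24)], and no causal construction yields a monotonic caging
law. [folklore] -/
theorem tp2Kernel_two_inputs {a c u v : ℝ} (ha : 0 < a) (hc : c < 1)
    (hau : a ≤ u) (hav : a ≤ v) (huc : u ≤ c) (hvc : v ≤ c)
    (h1 : u * v ≤ a * c) (h0 : (1 - u) * (1 - v) ≤ (1 - a) * (1 - c)) :
    (u = a ∧ v = c) ∨ (u = c ∧ v = a) := by
  have ha1 : 0 < 1 - a := sub_pos.2 (lt_of_le_of_lt (hau.trans huc) hc)
  have hP : 0 ≤ (u - a) * (v - a) := mul_nonneg (sub_nonneg.2 hau) (sub_nonneg.2 hav)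
  have hprod : u * v = a * c := by
    refine le_antisymm h1 ?_
    nlinarith [hP, h0, ha, ha1]
  have hsum : u + v = a + c := by
    refine le_antisymm ?_ ?_
    · nlinarith [hP, hprod, ha]
    · nlinarith [h0, hprod]
  have hroot : (u - a) * (u - c) = 0 := by linear_combination u * hsum - hprod
  rcases mul_eq_zero.1 hroot with h | h
  · exact Or.inl ⟨by linarith, by linarith⟩
  · exact Or.inr ⟨by linarith, by linarith⟩

end Literature.Barriers.CriticalPhenomena
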